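import Mathlib
import HarnessLib
import Summits.Ventures.LatticeQCDFlow.Exactness.NCMCGeneralSpaceGammaMethodWindow
import Summits.Ventures.LatticeQCDFlow.Exactness.NCMCGeneralSpaceBarPairsEveryStart
import Summits.Ventures.LatticeQCDFlow.Exactness.NCMCGeneralSpaceBennettRootVariance

/-!
# Two chains run independently: the autocovariances of `a(X_t) + b(Y_t)` along `κ₁ ∥ₖ κ₂` are the sums of the legs' — so the BAR lane's `σ²_pair` is `σ²_fwd + σ²_rev`, each a one-stream Green–Kubo variance

HONEST FRAMING: exact (Metropolis-corrected) sampling algorithms for lattice gauge theory;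
figures of merit are autocorrelation/cost numbers at stated couplings and volumes; no
continuum-physics claim.

Venture `LatticeQCDFlow` (cell pub-lqcd), topic `Exactness`; FANOUT row 13 (`eng-snf`, GEN-22).
NEW WORK of the cell, not a published result; no definition is introduced; nothing is cited as a
fact.  `NCMCGeneralSpaceBarRestartChainsCLT.lean` (GEN-22) gives the BAR estimate from two
INDEPENDENT streams of correlated launches the limit law `N(0, σ²_pair/G²)`, `σ²_pair` the Green–Kubo
variance of the Bennett summand `ψ(ω, ω') = σ(ΔF − W ω) − σ(W ω' − ΔF)` along the PAIR chain
`R₀ ∥ₖ R₁`.  This file reads `σ²_pair` leg by leg: the transition operator of a parallel product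
acts factor-wise on tensor observables (`integral_prod_mul`), hence additively on
`a ∘ fst + b ∘ snd`; under a product law with centred legs the cross terms vanish at every lag, so
`C_{a⊕b}(t) = C_a(t) + C_b(t)` and, the legs' series being summable under their own Doeblin powers
(GEN-20 `summable_autocov_centred_succ_of_nHit`), `σ²_{a⊕b} = σ²_a + σ²_b`.  For BAR:
`σ²_pair = σ²_F[σ(ΔF − W)] + σ²_R[σ(W − ΔF)]` — each the Green–Kubo variance of a bounded Fermi
weight along ONE restart chain, i.e. exactly the quantity scorer A's Γ-method estimates consistently
on each stream (GEN-20), which is what a studentized BAR error bar along correlated launches needs.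

## Content (`κ₁`, `κ₂` Markov on `S₁`, `S₂`; `a`, `b` bounded measurable; `π₁`, `π₂` probability laws)

* **`kop_parallelComp_tensor`** — `kop (κ₁ ∥ₖ κ₂) (a ⊗ b) = kop κ₁ a ⊗ kop κ₂ b`;
  `kop_parallelComp_fst`, `kop_parallelComp_snd`, **`iterate_kop_parallelComp_add`** —
  `(kop (κ₁ ∥ₖ κ₂))^[t] (a ∘ fst + b ∘ snd) = ((kop κ₁)^[t] a) ∘ fst + ((kop κ₂)^[t] b) ∘ snd`.
* **`autocov_parallelComp_add`** — `∫ a dπ₁ = 0 = ∫ b dπ₂` ⇒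
  `autocov (κ₁ ∥ₖ κ₂) (π₁ ⊗ π₂) (a ∘ fst + b ∘ snd) t = autocov κ₁ π₁ a t + autocov κ₂ π₂ b t`.
* **`greenKubo_parallelComp_add_of_nHit`** — Doeblin powers on both legs, `πᵢ` invariant:
  `σ²_{f₁∘fst + f₂∘snd} = σ²_{f₁} + σ²_{f₂}` (centred forms).
* **`CrooksPair.barPairVariance_eq_add`** — for the two restart chains of a Crooks pair
  (`e^{−ΔF} = Z₁/Z₀`, minorised level samplers): `σ²_pair = σ²_fwd + σ²_rev` with
  `σ²_fwd` the Green–Kubo variance of `σ(ΔF − W)` along the forward chain under `P_F` and `σ²_rev` that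
  of `σ(W − ΔF)` along the reverse chain under `P_R`.

NOT CLAIMED: dependent legs; a consistent estimator of `σ²_pair` (the two one-stream Γ-method
statistics are the candidates); anything numerical.
-/

namespace Summit.Ventures.LatticeQCDFlow.Exactness.GeneralNCMC

open MeasureTheory ProbabilityTheory Set Filter Finset
open scoped ENNReal Topology

/-! ## §1 The transition operator of a parallel product on sums of one-leg observables -/

section Parallel

variable {S₁ S₂ : Type*} [MeasurableSpace S₁] [MeasurableSpace S₂]
variable (κ₁ : Kernel S₁ S₁) (κ₂ : Kernel S₂ S₂) [IsMarkovKernel κ₁] [IsMarkovKernel κ₂]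

/-- **Tensor observables**: `kop (κ₁ ∥ₖ κ₂) (p ↦ a p.1 · b p.2) p = kop κ₁ a p.1 · kop κ₂ b p.2`. -/
theorem kop_parallelComp_tensor (a : S₁ → ℝ) (b : S₂ → ℝ) (p : S₁ × S₂) :
    Scoring.kop (κ₁ ∥ₖ κ₂) (fun q : S₁ × S₂ => a q.1 * b q.2) p
      = Scoring.kop κ₁ a p.1 * Scoring.kop κ₂ b p.2 := by
  simp only [Scoring.kop]
  rw [Kernel.parallelComp_apply, integral_prod_mul]

/-- First-leg observables: `kop (κ₁ ∥ₖ κ₂) (a ∘ fst) p = kop κ₁ a p.1`. -/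
theorem kop_parallelComp_fst (a : S₁ → ℝ) (p : S₁ × S₂) :
    Scoring.kop (κ₁ ∥ₖ κ₂) (fun q : S₁ × S₂ => a q.1) p = Scoring.kop κ₁ a p.1 := by
  have h := kop_parallelComp_tensor κ₁ κ₂ a (fun _ => (1 : ℝ)) p
  simp only [mul_one] at h
  rw [h]
  simp only [Scoring.kop, integral_const, probReal_univ, one_smul, mul_one]

/-- Second-leg observables: `kop (κ₁ ∥ₖ κ₂) (b ∘ snd) p = kop κ₂ b p.2`. -/
theorem kop_parallelComp_snd (b : S₂ → ℝ) (p : S₁ × S₂) :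
    Scoring.kop (κ₁ ∥ₖ κ₂) (fun q : S₁ × S₂ => b q.2) p = Scoring.kop κ₂ b p.2 := by
  have h := kop_parallelComp_tensor κ₁ κ₂ (fun _ => (1 : ℝ)) b p
  simp only [one_mul] at h
  rw [h]
  simp only [Scoring.kop, integral_const, probReal_univ, one_smul, one_mul]

/-- **Sums of one-leg observables, iterated**:
`(kop (κ₁ ∥ₖ κ₂))^[t] (a ∘ fst + b ∘ snd) = ((kop κ₁)^[t] a) ∘ fst + ((kop κ₂)^[t] b) ∘ snd` for bounded
measurable `a`, `b`. -/
theorem iterate_kop_parallelComp_add {a : S₁ → ℝ} (ha : Measurable a) {Ca : ℝ} (hCa : ∀ x, |a x| ≤ Ca)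
    {b : S₂ → ℝ} (hb : Measurable b) {Cb : ℝ} (hCb : ∀ y, |b y| ≤ Cb) :
    ∀ t : ℕ, (Scoring.kop (κ₁ ∥ₖ κ₂))^[t] (fun q : S₁ × S₂ => a q.1 + b q.2)
      = fun q => (Scoring.kop κ₁)^[t] a q.1 + (Scoring.kop κ₂)^[t] b q.2
  | 0 => rfl
  | t + 1 => by
    obtain ⟨ham, hab⟩ := Scoring.iterate_kop_bounded_measurable κ₁ ha hCa t
    obtain ⟨hbm, hbb⟩ := Scoring.iterate_kop_bounded_measurable κ₂ hb hCb t
    rw [Function.iterate_succ_apply', iterate_kop_parallelComp_add ha hCa hb hCb t,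
      Function.iterate_succ_apply', Function.iterate_succ_apply']
    funext q
    have hi1 : Integrable (fun r : S₁ × S₂ => (Scoring.kop κ₁)^[t] a r.1) ((κ₁ ∥ₖ κ₂) q) :=
      Scoring.integrable_of_bounded _ (ham.comp measurable_fst) fun r => hab _
    have hi2 : Integrable (fun r : S₁ × S₂ => (Scoring.kop κ₂)^[t] b r.2) ((κ₁ ∥ₖ κ₂) q) :=
      Scoring.integrable_of_bounded _ (hbm.comp measurable_snd) fun r => hbb _
    show ∫ r, ((Scoring.kop κ₁)^[t] a r.1 + (Scoring.kop κ₂)^[t] b r.2) ∂((κ₁ ∥ₖ κ₂) q) = _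
    rw [integral_add hi1 hi2]
    exact congrArg₂ (· + ·) (kop_parallelComp_fst κ₁ κ₂ _ q) (kop_parallelComp_snd κ₁ κ₂ _ q)

/-! ## §2 Autocovariances under a product law with centred legs -/

variable {κ₁ κ₂}
variable {π₁ : Measure S₁} {π₂ : Measure S₂} [IsProbabilityMeasure π₁] [IsProbabilityMeasure π₂]

/-- **`C_{a⊕b}(t) = C_a(t) + C_b(t)`**: for bounded measurable `a`, `b` with `∫ a dπ₁ = 0 = ∫ b dπ₂`,
`autocov (κ₁ ∥ₖ κ₂) (π₁ ⊗ π₂) (a ∘ fst + b ∘ snd) t = autocov κ₁ π₁ a t + autocov κ₂ π₂ b t`. -/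
theorem autocov_parallelComp_add {a : S₁ → ℝ} (ha : Measurable a) {Ca : ℝ} (hCa : ∀ x, |a x| ≤ Ca)
    (ha0 : ∫ x, a x ∂π₁ = 0) {b : S₂ → ℝ} (hb : Measurable b) {Cb : ℝ} (hCb : ∀ y, |b y| ≤ Cb)
    (hb0 : ∫ y, b y ∂π₂ = 0) (t : ℕ) :
    Scoring.autocov (κ₁ ∥ₖ κ₂) (π₁.prod π₂) (fun q : S₁ × S₂ => a q.1 + b q.2) t
      = Scoring.autocov κ₁ π₁ a t + Scoring.autocov κ₂ π₂ b t := by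
  obtain ⟨ham, hab⟩ := Scoring.iterate_kop_bounded_measurable κ₁ ha hCa t
  obtain ⟨hbm, hbb⟩ := Scoring.iterate_kop_bounded_measurable κ₂ hb hCb t
  have hCa0 : 0 ≤ Ca := (abs_nonneg _).trans (hCa (Classical.choice (nonempty_of_isProbabilityMeasure π₁)))
  have hCb0 : 0 ≤ Cb := (abs_nonneg _).trans (hCb (Classical.choice (nonempty_of_isProbabilityMeasure π₂)))
  set A := (Scoring.kop κ₁)^[t] a with hA
  set B := (Scoring.kop κ₂)^[t] b with hB
  unfold Scoring.autocov
  rw [iterate_kop_parallelComp_add κ₁ κ₂ ha hCa hb hCb t]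
  simp only
  have hexp : (fun q : S₁ × S₂ => (a q.1 + b q.2) * (A q.1 + B q.2))
      = fun q => (a q.1 * A q.1) * 1 + 1 * (b q.2 * B q.2) + a q.1 * B q.2 + A q.1 * b q.2 := by
    funext q; ring
  -- integrability on the product law
  have hμ : IsProbabilityMeasure (π₁.prod π₂) := inferInstance
  have i1 : Integrable (fun q : S₁ × S₂ => (a q.1 * A q.1) * 1) (π₁.prod π₂) :=
    Scoring.integrable_of_bounded _ (((ha.mul ham).comp measurable_fst).mul measurable_const)
      (C := Ca * Ca * 1) fun q => by
        rw [abs_mul, abs_mul, abs_one]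
        exact mul_le_mul (mul_le_mul (hCa _) (hab _) (abs_nonneg _) hCa0) le_rfl zero_le_one
          (mul_nonneg hCa0 hCa0)
  have i2 : Integrable (fun q : S₁ × S₂ => 1 * (b q.2 * B q.2)) (π₁.prod π₂) :=
    Scoring.integrable_of_bounded _ (measurable_const.mul ((hb.mul hbm).comp measurable_snd))
      (C := 1 * (Cb * Cb)) fun q => by
        rw [abs_mul, abs_mul, abs_one]
        exact mul_le_mul le_rfl (mul_le_mul (hCb _) (hbb _) (abs_nonneg _) hCb0)
          (mul_nonneg (abs_nonneg _) (abs_nonneg _)) zero_le_one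
  have i3 : Integrable (fun q : S₁ × S₂ => a q.1 * B q.2) (π₁.prod π₂) :=
    Scoring.integrable_of_bounded _ ((ha.comp measurable_fst).mul (hbm.comp measurable_snd))
      (C := Ca * Cb) fun q => by
        rw [abs_mul]; exact mul_le_mul (hCa _) (hbb _) (abs_nonneg _) hCa0
  have i4 : Integrable (fun q : S₁ × S₂ => A q.1 * b q.2) (π₁.prod π₂) :=
    Scoring.integrable_of_bounded _ ((ham.comp measurable_fst).mul (hb.comp measurable_snd))
      (C := Ca * Cb) fun q => by
        rw [abs_mul]; exact mul_le_mul (hab _) (hCb _) (abs_nonneg _) hCa0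
  have i12 : Integrable (fun q : S₁ × S₂ => (a q.1 * A q.1) * 1 + 1 * (b q.2 * B q.2)) (π₁.prod π₂) :=
    i1.add i2
  have i123 : Integrable (fun q : S₁ × S₂ => (a q.1 * A q.1) * 1 + 1 * (b q.2 * B q.2) + a q.1 * B q.2)
      (π₁.prod π₂) := i12.add i3
  rw [hexp, integral_add i123 i4, integral_add i12 i3, integral_add i1 i2,
    integral_prod_mul (fun x => a x * A x) (fun _ => (1 : ℝ)),
    integral_prod_mul (fun _ => (1 : ℝ)) (fun y => b y * B y),
    integral_prod_mul (fun x => a x) (fun y => B y),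
    integral_prod_mul (fun x => A x) (fun y => b y)]
  simp only [integral_const, probReal_univ, one_smul, mul_one, one_mul, ha0, hb0, zero_mul, mul_zero,
    add_zero]
  rfl

variable {ν₁' : Measure S₁} {ν₂' : Measure S₂} [IsProbabilityMeasure ν₁'] [IsProbabilityMeasure ν₂']
  {ε₁ ε₂ : ℝ≥0∞} {m₁ m₂ : ℕ}

/-- **`σ²_{f₁∘fst + f₂∘snd} = σ²_{f₁} + σ²_{f₂}`** (Green–Kubo variances in row 8's centred form): two
Markov kernels with Doeblin powers `(nHit κᵢ mᵢ)(x, ·) ≥ εᵢ νᵢ` (`0 < εᵢ ≤ 1`, `0 < mᵢ`) and invariant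
probability laws `πᵢ`, bounded measurable `fᵢ`. -/
theorem greenKubo_parallelComp_add_of_nHit
    (hmin₁ : ∀ x {B : Set S₁}, MeasurableSet B → ε₁ * ν₁' B ≤ nHit κ₁ m₁ x B) (hε₁0 : 0 < ε₁)
    (hε₁1 : ε₁ ≤ 1) (hm₁ : 0 < m₁) (hπ₁ : Kernel.Invariant κ₁ π₁)
    (hmin₂ : ∀ y {B : Set S₂}, MeasurableSet B → ε₂ * ν₂' B ≤ nHit κ₂ m₂ y B) (hε₂0 : 0 < ε₂)
    (hε₂1 : ε₂ ≤ 1) (hm₂ : 0 < m₂) (hπ₂ : Kernel.Invariant κ₂ π₂)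
    {f₁ : S₁ → ℝ} (hf₁ : Measurable f₁) {C₁ : ℝ} (hC₁ : ∀ x, |f₁ x| ≤ C₁)
    {f₂ : S₂ → ℝ} (hf₂ : Measurable f₂) {C₂ : ℝ} (hC₂ : ∀ y, |f₂ y| ≤ C₂) :
    Scoring.autocov (κ₁ ∥ₖ κ₂) (π₁.prod π₂)
          (fun q : S₁ × S₂ => (f₁ q.1 - ∫ z, f₁ z ∂π₁) + (f₂ q.2 - ∫ z, f₂ z ∂π₂)) 0
        + 2 * ∑' t, Scoring.autocov (κ₁ ∥ₖ κ₂) (π₁.prod π₂)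
          (fun q : S₁ × S₂ => (f₁ q.1 - ∫ z, f₁ z ∂π₁) + (f₂ q.2 - ∫ z, f₂ z ∂π₂)) (t + 1)
      = (Scoring.autocov κ₁ π₁ (fun x => f₁ x - ∫ z, f₁ z ∂π₁) 0
          + 2 * ∑' t, Scoring.autocov κ₁ π₁ (fun x => f₁ x - ∫ z, f₁ z ∂π₁) (t + 1))
        + (Scoring.autocov κ₂ π₂ (fun y => f₂ y - ∫ z, f₂ z ∂π₂) 0
          + 2 * ∑' t, Scoring.autocov κ₂ π₂ (fun y => f₂ y - ∫ z, f₂ z ∂π₂) (t + 1)) := by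
  obtain ⟨ha, hCa, ha0⟩ := Scoring.centred_observable_bounds π₁ hf₁ hC₁
  obtain ⟨hb, hCb, hb0⟩ := Scoring.centred_observable_bounds π₂ hf₂ hC₂
  have hsum₁ := summable_autocov_centred_succ_of_nHit hmin₁ hε₁0 hε₁1 hm₁ hπ₁ hf₁ hC₁
  have hsum₂ := summable_autocov_centred_succ_of_nHit hmin₂ hε₂0 hε₂1 hm₂ hπ₂ hf₂ hC₂
  have key : ∀ t, Scoring.autocov (κ₁ ∥ₖ κ₂) (π₁.prod π₂)
      (fun q : S₁ × S₂ => (f₁ q.1 - ∫ z, f₁ z ∂π₁) + (f₂ q.2 - ∫ z, f₂ z ∂π₂)) t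
      = Scoring.autocov κ₁ π₁ (fun x => f₁ x - ∫ z, f₁ z ∂π₁) t
        + Scoring.autocov κ₂ π₂ (fun y => f₂ y - ∫ z, f₂ z ∂π₂) t := fun t =>
    autocov_parallelComp_add (a := fun x => f₁ x - ∫ z, f₁ z ∂π₁) ha hCa ha0
      (b := fun y => f₂ y - ∫ z, f₂ z ∂π₂) hb hCb hb0 t
  simp_rw [key]
  rw [hsum₁.tsum_add hsum₂]
  ring

end Parallel

/-! ## §3 Sign flips do not change autocovariances -/

section Neg

variable {S : Type*} [MeasurableSpace S] (κ : Kernel S S)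

/-- `(kop κ)^[t] (−g) = −(kop κ)^[t] g`. -/
theorem iterate_kop_neg (g : S → ℝ) :
    ∀ t : ℕ, (Scoring.kop κ)^[t] (fun x => -g x) = fun x => -((Scoring.kop κ)^[t] g x)
  | 0 => rfl
  | t + 1 => by
    rw [Function.iterate_succ_apply', iterate_kop_neg g t, Function.iterate_succ_apply']
    have h1 : (fun x => -((Scoring.kop κ)^[t] g x)) = fun x => (-1) * (Scoring.kop κ)^[t] g x := by
      funext x; ring
    rw [h1, Scoring.kop_const_mul]
    funext x; ring

/-- `autocov κ π (−g) t = autocov κ π g t`. -/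
theorem autocov_neg (π : Measure S) (g : S → ℝ) (t : ℕ) :
    Scoring.autocov κ π (fun x => -g x) t = Scoring.autocov κ π g t := by
  unfold Scoring.autocov
  rw [iterate_kop_neg κ g t]
  simp only [neg_mul, mul_neg, neg_neg]

end Neg

/-! ## §4 The BAR lane: `σ²_pair = σ²_fwd + σ²_rev` -/

namespace CrooksPair

variable {Ω E : Type*} [MeasurableSpace Ω] [MeasurableSpace E]
variable {ν₀ ν₁ : Measure Ω} [IsFiniteMeasure ν₀] [IsFiniteMeasure ν₁] {κF κR : Kernel Ω E}
  [IsMarkovKernel κF] [IsMarkovKernel κR] {s e : E → Ω} {W : E → ℝ}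

/-- **THE BAR PAIR VARIANCE IS THE SUM OF THE TWO STREAMS' GREEN–KUBO VARIANCES.**  Crooks pair with
`Z₀, Z₁ ≠ 0`, `e^{−ΔF} = Z₁/Z₀`; `ν₀`-invariant `K₀` and `ν₁`-invariant `K₁` dominating non-zero finite
`m₀`, `m₁` from every configuration; `R₀ = (κF ∘ₖ K₀).comap s`, `R₁ = (κR ∘ₖ K₁).comap e`,
`ψ(p) = σ(ΔF − W p.1) − σ(W p.2 − ΔF)`.  Then the Green–Kubo variance of `ψ` along `R₀ ∥ₖ R₁` under
`P_F ⊗ P_R` (the `σ²_pair` of `NCMCGeneralSpaceBarRestartChainsCLT`) is the Green–Kubo variance of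
`σ(ΔF − W)` along `R₀` under `P_F` plus that of `σ(W − ΔF)` along `R₁` under `P_R`. -/
theorem barPairVariance_eq_add (K₀ K₁ : Kernel Ω Ω) [IsMarkovKernel K₀] [IsMarkovKernel K₁]
    (h0 : ν₀ univ ≠ 0) (h1 : ν₁ univ ≠ 0) (hK₀ : Kernel.Invariant K₀ ν₀)
    (hK₁ : Kernel.Invariant K₁ ν₁) (h : CrooksPair ν₀ ν₁ κF κR s e W) {ΔF : ℝ}
    (hΔF : Real.exp (-ΔF) = ((ν₀ univ)⁻¹ * ν₁ univ).toReal)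
    {m₀ m₁ : Measure Ω} [IsFiniteMeasure m₀] [IsFiniteMeasure m₁] (hm₀ : m₀ univ ≠ 0)
    (hm₁ : m₁ univ ≠ 0) (hmin₀ : ∀ z, m₀ ≤ K₀ z) (hmin₁ : ∀ z, m₁ ≤ K₁ z) :
    Scoring.autocov (((κF ∘ₖ K₀).comap s h.measurable_s) ∥ₖ ((κR ∘ₖ K₁).comap e h.measurable_e))
          ((fwdPathLaw ν₀ κF).prod (fwdPathLaw ν₁ κR))
          (fun p : E × E => Real.sigmoid (ΔF - W p.1) - Real.sigmoid (W p.2 - ΔF)) 0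
        + 2 * ∑' t, Scoring.autocov
            (((κF ∘ₖ K₀).comap s h.measurable_s) ∥ₖ ((κR ∘ₖ K₁).comap e h.measurable_e))
            ((fwdPathLaw ν₀ κF).prod (fwdPathLaw ν₁ κR))
            (fun p : E × E => Real.sigmoid (ΔF - W p.1) - Real.sigmoid (W p.2 - ΔF)) (t + 1)
      = (Scoring.autocov ((κF ∘ₖ K₀).comap s h.measurable_s) (fwdPathLaw ν₀ κF)
            (fun ω => Real.sigmoid (ΔF - W ω) - ∫ z, Real.sigmoid (ΔF - W z) ∂(fwdPathLaw ν₀ κF)) 0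
          + 2 * ∑' t, Scoring.autocov ((κF ∘ₖ K₀).comap s h.measurable_s) (fwdPathLaw ν₀ κF)
            (fun ω => Real.sigmoid (ΔF - W ω) - ∫ z, Real.sigmoid (ΔF - W z) ∂(fwdPathLaw ν₀ κF))
            (t + 1))
        + (Scoring.autocov ((κR ∘ₖ K₁).comap e h.measurable_e) (fwdPathLaw ν₁ κR)
            (fun ω => Real.sigmoid (W ω - ΔF) - ∫ z, Real.sigmoid (W z - ΔF) ∂(fwdPathLaw ν₁ κR)) 0
          + 2 * ∑' t, Scoring.autocov ((κR ∘ₖ K₁).comap e h.measurable_e) (fwdPathLaw ν₁ κR)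
            (fun ω => Real.sigmoid (W ω - ΔF) - ∫ z, Real.sigmoid (W z - ΔF) ∂(fwdPathLaw ν₁ κR))
            (t + 1)) := by
  haveI := isProbabilityMeasure_fwdPathLaw ν₀ h0 κF
  haveI := isProbabilityMeasure_fwdPathLaw ν₁ h1 κR
  haveI := isProbabilityMeasure_normalised_bind_kernel κF hm₀
  haveI := isProbabilityMeasure_normalised_bind_kernel κR hm₁
  set R₀ := (κF ∘ₖ K₀).comap s h.measurable_s with hR₀
  set R₁ := (κR ∘ₖ K₁).comap e h.measurable_e with hR₁
  -- one-step minorisations of the two restart kernels (GEN-18) and invariance (GEN-16)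
  have hD₀ := restartKernel_nHit_one_minorised K₀ h hm₀ hmin₀
  have hD₁ := h.symm.restartKernel_nHit_one_minorised K₁ hm₁ hmin₁
  have hI₀ := h.invariant_restartKernel K₀ hK₀
  have hI₁ := h.invariant_restartKernel_rev K₁ hK₁
  haveI : Nonempty E := nonempty_of_isProbabilityMeasure (fwdPathLaw ν₀ κF)
  have hε₀1 : m₀ univ ≤ 1 := by
    haveI := isMarkovKernel_nHit R₀ 1
    exact eps_le_one_of_minorised hD₀
  have hε₁1 : m₁ univ ≤ 1 := by
    haveI := isMarkovKernel_nHit R₁ 1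
    exact eps_le_one_of_minorised hD₁
  -- the two legs
  have hσm : Measurable Real.sigmoid := _root_.continuous_sigmoid.measurable
  have hf₁ : Measurable fun ω : E => Real.sigmoid (ΔF - W ω) :=
    hσm.comp (measurable_const.sub h.measurable_W)
  have hf₂ : Measurable fun ω : E => -Real.sigmoid (W ω - ΔF) :=
    (hσm.comp (h.measurable_W.sub measurable_const)).neg
  have hC₁ : ∀ ω : E, |Real.sigmoid (ΔF - W ω)| ≤ 1 := fun ω => by
    rw [abs_of_nonneg (Real.sigmoid_nonneg _)]; exact Real.sigmoid_le_one _
  have hC₂ : ∀ ω : E, |-Real.sigmoid (W ω - ΔF)| ≤ 1 := fun ω => by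
    rw [abs_neg, abs_of_nonneg (Real.sigmoid_nonneg _)]; exact Real.sigmoid_le_one _
  have key := greenKubo_parallelComp_add_of_nHit (κ₁ := R₀) (κ₂ := R₁) (π₁ := fwdPathLaw ν₀ κF)
    (π₂ := fwdPathLaw ν₁ κR)
    (fun x B hB => minorised_setwise hD₀ x hB) (pos_iff_ne_zero.2 hm₀) hε₀1 Nat.one_pos hI₀
    (fun y B hB => minorised_setwise hD₁ y hB) (pos_iff_ne_zero.2 hm₁) hε₁1 Nat.one_pos hI₁
    hf₁ hC₁ hf₂ hC₂
  -- the population root: `E_F σ(ΔF − W) = E_R σ(W − ΔF)`, so `ψ = a ∘ fst + b ∘ snd` with centred legs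
  have hroot : ∫ z, Real.sigmoid (ΔF - W z) ∂(fwdPathLaw ν₀ κF)
      = ∫ z, Real.sigmoid (W z - ΔF) ∂(fwdPathLaw ν₁ κR) :=
    (h.integral_sigmoid_fwd_eq_rev_iff h0 h1 hΔF ΔF).2 rfl
  have hneg : ∫ z, -Real.sigmoid (W z - ΔF) ∂(fwdPathLaw ν₁ κR)
      = -∫ z, Real.sigmoid (W z - ΔF) ∂(fwdPathLaw ν₁ κR) := integral_neg _
  have hψ : (fun p : E × E => Real.sigmoid (ΔF - W p.1) - Real.sigmoid (W p.2 - ΔF))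
      = fun p : E × E => (Real.sigmoid (ΔF - W p.1) - ∫ z, Real.sigmoid (ΔF - W z) ∂(fwdPathLaw ν₀ κF))
        + (-Real.sigmoid (W p.2 - ΔF) - ∫ z, -Real.sigmoid (W z - ΔF) ∂(fwdPathLaw ν₁ κR)) := by
    funext p; rw [hneg, hroot]; ring
  rw [hψ, key]
  -- the reverse leg: a sign flip
  have hb : (fun ω : E => -Real.sigmoid (W ω - ΔF) - ∫ z, -Real.sigmoid (W z - ΔF) ∂(fwdPathLaw ν₁ κR))
      = fun ω => -(Real.sigmoid (W ω - ΔF) - ∫ z, Real.sigmoid (W z - ΔF) ∂(fwdPathLaw ν₁ κR)) := by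
    funext ω; rw [hneg]; ring
  rw [hb]
  simp_rw [autocov_neg]

end CrooksPair

end Summit.Ventures.LatticeQCDFlow.Exactness.GeneralNCMC
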